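/-
Copyright (c) 2026. All rights reserved.
Released under Apache 2.0 license as described in the file LICENSE.
-/
import Summits.AtomisticToContinuum.Crystallization.Theorems.ChartedZeroExcessLayeredLatticeLiouvilleVJ

/-!
# ChartedZeroExcessLayeredLatticeLiouville — part VK «ChainCoercive II»: deep rows are chain rows, collar rows are `O(R)`
  (decomp-a2c-lens-2, g57; helper of stmt-AtomisticToContinuum-26636, leaf (LD′) `ModalLipschitzZ`; brick (b1) of critic rows 915/919/923, memo NODE-g57j §2)

With `χ_ρ = cutProfile (planarBall (ρ + r)) cf` (`r = ⌊ϱ/c⌋₊`, `supp cf ⊆ S`), UT `truncForm_coercive` gives `(2κ₀ − ε)·nnFormZ χ_ρ ≤ Q_ϱ(χ_ρ) =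
Σ_{p, q ∈ P} nearFam χ_ρ (p, q)`, `P = nearSet (planarBall (ρ+r) ×ˢ S)`. This part evaluates the right-hand side row by row:
* VK.1 `deep_row_eq`: a row `p` whose `ϱ`-neighbourhood stays inside the cut cylinder equals the CHAIN ROW `Σ_{β ∈ W} chainT cf p.2 β` (any `W ⊇ S`
  closed under the band `c|β − α| ≤ ϱ` around `S`); `deep_total_eq`: the rows over `p.1 ∈ planarBall ρ` sum to `(2ρ+1)² · Σ_{α,β ∈ W} chainT cf α β`;
* VK.2 `rest_total_le`: the remaining rows (a collar of `≤ 8r(2ρ+2r+1)·#layerCollar S r` sites) total at most that count times VJ's uniform row bound.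
Part VL divides by `(2(ρ+r)+1)²` and lets `ρ → ∞`.
-/

namespace Summit.AtomisticToContinuum.Crystallization.Theorems.ChartedZeroExcessLayeredLatticeLiouville

open Summit.AtomisticToContinuum.Crystallization.Theorems.ChartedPlanarOrderRigidityDoor (E3)
open Finset
open scoped InnerProductSpace RealInnerProductSpace BigOperators

noncomputable section ChainCoerciveII

variable {c : ℝ} {a b : E3} {w : ℤ → E3}

/-! ### VK.1  Deep rows are chain rows -/

/-- a non-zero chain entry `chainT cf α β ≠ 0` lies in the band and has a non-zero profile value at one end; hence both its indices lie in every
band-closed `W ⊇ S`. [formal bookkeeping] -/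
theorem mem_of_chainT_ne_zero (hc : 0 < c) (hL : IsLayeredCrystal c a b w) {ϱ : ℝ} {cf : ℤ → E3} {S W : Finset ℤ}
    (hS : ∀ α, α ∉ S → cf α = 0) (hSW : S ⊆ W) (hW : ∀ α ∈ S, ∀ β : ℤ, c * |(((β - α : ℤ)) : ℝ)| ≤ ϱ → β ∈ W) {α β : ℤ}
    (h : chainT ϱ a b w cf α β ≠ 0) : α ∈ W ∧ β ∈ W := by
  have hK : chainK ϱ a b w ((0 : Cell 2), α) β (cf β - cf α) ≠ 0 := fun h0 => h (by unfold chainT; rw [h0, inner_zero_right])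
  obtain ⟨hband, hval⟩ := band_of_chainK_ne_zero hc hL (X := ((0 : Cell 2), α)) hK
  have hband' : c * |(((α - β : ℤ)) : ℝ)| ≤ ϱ := by rwa [Int.cast_sub, abs_sub_comm, ← Int.cast_sub]
  rcases hval with hα | hβ
  · have hαS : α ∈ S := by by_contra hn; exact hα (hS α hn)
    exact ⟨hSW hαS, hW α hαS β hband⟩
  · have hβS : β ∈ S := by by_contra hn; exact hβ (hS β hn)
    exact ⟨hW β hβS α hband', hSW hβS⟩

/-- a bond term with both end values zero vanishes. [formal bookkeeping] -/
theorem nearFam_eq_zero_of_apply_eq_zero (ϱ : ℝ) (a b : E3) (w : ℤ → E3) {χ : Cell 2 → ℤ → E3} {p q : Cell 2 × ℤ}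
    (hp : χ p.1 p.2 = 0) (hq : χ q.1 q.2 = 0) : nearFam ϱ a b w χ (p, q) = 0 := by
  unfold nearFam
  dsimp only
  rw [hp, hq, sub_zero, inner_zero_left]

/-- ★ DEEP ROW = CHAIN ROW: if the whole `ϱ`-neighbourhood of `p` has in-plane part inside the cut `B`, the `p`-row of the truncated form of
`cutProfile B cf` over the near set of the cylinder `B ×ˢ S` is the chain row `Σ_{β ∈ W} chainT cf p.2 β`. [this file, g57] -/
theorem deep_row_eq (hc : 0 < c) (hL : IsLayeredCrystal c a b w) {ϱ : ℝ} (hϱ : 0 ≤ ϱ) {cf : ℤ → E3} {S W : Finset ℤ}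
    (hS : ∀ α, α ∉ S → cf α = 0) (hSW : S ⊆ W) (hW : ∀ α ∈ S, ∀ β : ℤ, c * |(((β - α : ℤ)) : ℝ)| ≤ ϱ → β ∈ W)
    {B : Finset (Cell 2)} {p : Cell 2 × ℤ}
    (hdeep : ∀ Y : Cell 2 × ℤ, ‖lsite a b w Y.1 Y.2 - lsite a b w p.1 p.2‖ ≤ ϱ → Y.1 ∈ B) (hp : p.1 ∈ B) :
    ∑ q ∈ nearSet hc hL ϱ (B ×ˢ S), nearFam ϱ a b w (cutProfile B cf) (p, q) = ∑ β ∈ W, chainT ϱ a b w cf p.2 β := by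
  have hN0P : B ×ˢ S ⊆ nearSet hc hL ϱ (B ×ˢ S) := fun X hX => mem_nearSet_self hc hL hϱ hX
  have hN : ∀ Y : Cell 2 × ℤ, ‖lsite a b w Y.1 Y.2 - lsite a b w p.1 p.2‖ ≤ ϱ →
      Y ∈ nearSet hc hL ϱ (B ×ˢ S) ∪ (finite_near_lsite hc hL p ϱ).toFinset :=
    fun Y hY => mem_union_right _ ((finite_near_lsite hc hL p ϱ).mem_toFinset.mpr hY)
  have htr : ∀ (β : ℤ) (u : E3), chainK ϱ a b w p β u = chainK ϱ a b w ((0 : Cell 2), p.2) β u := by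
    intro β u
    have h := chainK_translate ϱ a b w p.1 p.2 β u
    rwa [Prod.mk.eta] at h
  -- step 1: extend the row to a set containing the whole neighbourhood (the added terms vanish)
  have h1 : ∑ q ∈ nearSet hc hL ϱ (B ×ˢ S), nearFam ϱ a b w (cutProfile B cf) (p, q) =
      ∑ q ∈ nearSet hc hL ϱ (B ×ˢ S) ∪ (finite_near_lsite hc hL p ϱ).toFinset, nearFam ϱ a b w (cutProfile B cf) (p, q) := by
    refine sum_subset subset_union_left fun q hqN hqP => ?_
    have hq : ‖lsite a b w q.1 q.2 - lsite a b w p.1 p.2‖ ≤ ϱ := by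
      rcases mem_union.mp hqN with h | h
      · exact absurd h hqP
      · exact (finite_near_lsite hc hL p ϱ).mem_toFinset.mp h
    have hq0 : cutProfile B cf q.1 q.2 = 0 := cutProfile_eq_zero_of_not_mem hS q fun h => hqP (hN0P h)
    have hp0 : cutProfile B cf p.1 p.2 = 0 :=
      cutProfile_eq_zero_of_not_mem hS p fun h => hqP (mem_nearSet_of hc hL (X := p) (Y := q) h hq)
    exact nearFam_eq_zero_of_apply_eq_zero ϱ a b w hp0 hq0
  -- step 2: the row identity of VI and the passage to the canonical layer set `W`
  rw [h1, row_nearFam_cutProfile_eq cf (p := p) hN hdeep hp]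
  have hV : ∀ β, ⟪cf β - cf p.2, chainK ϱ a b w p β (cf β - cf p.2)⟫_ℝ ≠ 0 →
      β ∈ (nearSet hc hL ϱ (B ×ˢ S) ∪ (finite_near_lsite hc hL p ϱ).toFinset).image Prod.snd := by
    intro β hβ
    have hK : chainK ϱ a b w p β (cf β - cf p.2) ≠ 0 := fun h0 => hβ (by rw [h0, inner_zero_right])
    rw [chainK_eq_sum hN] at hK
    obtain ⟨Y, hY, _⟩ := exists_ne_zero_of_sum_ne_zero hK
    exact Finset.mem_image.mpr ⟨Y, (mem_filter.mp hY).1, (mem_filter.mp hY).2⟩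
  have hW' : ∀ β, ⟪cf β - cf p.2, chainK ϱ a b w p β (cf β - cf p.2)⟫_ℝ ≠ 0 → β ∈ W := by
    intro β hβ
    rw [htr] at hβ
    exact (mem_of_chainT_ne_zero hc hL hS hSW hW hβ).2
  rw [sum_eq_sum_of_support hV hW']
  refine sum_congr rfl fun β _ => ?_
  rw [htr]
  rfl

/-- a layer `α` with a non-zero chain row over a deep cell `γ ∈ planarBall ρ` indexes a site of the near set. [formal bookkeeping] -/
theorem mem_nearSet_of_chainT_ne_zero (hc : 0 < c) (hL : IsLayeredCrystal c a b w) {ϱ : ℝ} (hϱ : 0 ≤ ϱ) {cf : ℤ → E3} {S : Finset ℤ}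
    (hS : ∀ α, α ∉ S → cf α = 0) {ρ : ℕ} {γ : Cell 2} (hγ : γ ∈ planarBall ρ) {α β : ℤ} (h : chainT ϱ a b w cf α β ≠ 0) :
    (γ, α) ∈ nearSet hc hL ϱ (planarBall (ρ + ⌊ϱ / c⌋₊) ×ˢ S) := by
  have hK : chainK ϱ a b w ((0 : Cell 2), α) β (cf β - cf α) ≠ 0 := fun h0 => h (by unfold chainT; rw [h0, inner_zero_right])
  obtain ⟨_, hval⟩ := band_of_chainK_ne_zero hc hL (X := ((0 : Cell 2), α)) hK
  by_cases hαS : α ∈ S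
  · exact mem_nearSet_self hc hL hϱ (mem_product.mpr ⟨planarBall_mono (Nat.le_add_right _ _) hγ, hαS⟩)
  have hβS : β ∈ S := by
    rcases hval with hα | hβ
    · exact absurd (hS α hαS) hα
    · by_contra hn; exact hβ (hS β hn)
  -- some bond `(γ', β)` of the chain entry is near `(0, α)`; translate it by `γ`
  obtain ⟨γ', hγ'⟩ : ∃ γ' : Cell 2, nearK ϱ a b w ((0 : Cell 2), α) (γ', β) (cf β - cf α) ≠ 0 := by
    by_contra hall
    simp only [not_exists, not_not] at hall
    exact hK (by unfold chainK; exact finsum_eq_zero_of_forall_eq_zero hall)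
  have hnear : ‖lsite a b w γ' β - lsite a b w 0 α‖ ≤ ϱ :=
    not_lt.mp fun hlt => hγ' (nearK_eq_zero_of_lt (X := ((0 : Cell 2), α)) (Y := (γ', β)) hlt _)
  have hX : (γ + γ', β) ∈ planarBall (ρ + ⌊ϱ / c⌋₊) ×ˢ S := by
    refine mem_product.mpr ⟨add_mem_planarBall hγ fun j => ?_, hβS⟩
    have h1 := idxNorm_le_of_near hc hL (X := ((0 : Cell 2), α)) (Y := (γ', β)) hnear
    have h2 := natAbs_fst_le_idxNorm ((γ', β) - ((0 : Cell 2), α)) j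
    simp only [Prod.fst_sub, sub_zero] at h2
    exact h2.trans h1
  refine mem_nearSet_of hc hL hX ?_
  show ‖lsite a b w γ α - lsite a b w (γ + γ') β‖ ≤ ϱ
  rw [norm_sub_rev, lsite_sub_translate a b w γ (γ + γ') α β, add_sub_cancel_left]
  exact hnear

/-- ★ DEEP TOTAL: the rows over the deep cells `p.1 ∈ planarBall ρ` of `Q_ϱ(cutProfile (planarBall (ρ+r)) cf)` sum to `(2ρ+1)²` copies of the chain form.
[this file, g57] -/
theorem deep_total_eq (hc : 0 < c) (hL : IsLayeredCrystal c a b w) {ϱ : ℝ} (hϱ : 0 ≤ ϱ) {cf : ℤ → E3} {S W : Finset ℤ}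
    (hS : ∀ α, α ∉ S → cf α = 0) (hSW : S ⊆ W) (hW : ∀ α ∈ S, ∀ β : ℤ, c * |(((β - α : ℤ)) : ℝ)| ≤ ϱ → β ∈ W) (ρ : ℕ) :
    ∑ p ∈ (nearSet hc hL ϱ (planarBall (ρ + ⌊ϱ / c⌋₊) ×ˢ S)).filter (fun p => p.1 ∈ planarBall ρ),
        ∑ q ∈ nearSet hc hL ϱ (planarBall (ρ + ⌊ϱ / c⌋₊) ×ˢ S), nearFam ϱ a b w (cutProfile (planarBall (ρ + ⌊ϱ / c⌋₊)) cf) (p, q) =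
      (((2 * ρ + 1) ^ 2 : ℕ) : ℝ) * ∑ α ∈ W, ∑ β ∈ W, chainT ϱ a b w cf α β := by
  set P := nearSet hc hL ϱ (planarBall (ρ + ⌊ϱ / c⌋₊) ×ˢ S) with hP
  have hdeep : ∀ p : Cell 2 × ℤ, p.1 ∈ planarBall ρ →
      ∀ Y : Cell 2 × ℤ, ‖lsite a b w Y.1 Y.2 - lsite a b w p.1 p.2‖ ≤ ϱ → Y.1 ∈ planarBall (ρ + ⌊ϱ / c⌋₊) := by
    intro p hp Y hY
    have h1 : Y.1 = p.1 + (Y - p).1 := by simp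
    rw [h1]
    exact add_mem_planarBall hp fun j => (natAbs_fst_le_idxNorm (Y - p) j).trans (idxNorm_le_of_near hc hL hY)
  have hrow : ∀ p ∈ P.filter (fun p => p.1 ∈ planarBall ρ),
      ∑ q ∈ P, nearFam ϱ a b w (cutProfile (planarBall (ρ + ⌊ϱ / c⌋₊)) cf) (p, q) = ∑ β ∈ W, chainT ϱ a b w cf p.2 β := by
    intro p hp
    have hp1 := (mem_filter.mp hp).2
    exact deep_row_eq hc hL hϱ hS hSW hW (hdeep p hp1) (planarBall_mono (Nat.le_add_right _ _) hp1)
  rw [sum_congr rfl hrow, ← sum_fiberwise_of_maps_to (g := Prod.fst) (t := planarBall ρ) fun p hp => (mem_filter.mp hp).2]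
  have hinner : ∀ γ ∈ planarBall ρ,
      ∑ p ∈ (P.filter (fun p => p.1 ∈ planarBall ρ)).filter (fun p => p.1 = γ), ∑ β ∈ W, chainT ϱ a b w cf p.2 β =
        ∑ α ∈ W, ∑ β ∈ W, chainT ϱ a b w cf α β := by
    intro γ hγ
    have himg : ∑ p ∈ (P.filter (fun p => p.1 ∈ planarBall ρ)).filter (fun p => p.1 = γ), ∑ β ∈ W, chainT ϱ a b w cf p.2 β =
        ∑ α ∈ ((P.filter (fun p => p.1 ∈ planarBall ρ)).filter (fun p => p.1 = γ)).image Prod.snd, ∑ β ∈ W, chainT ϱ a b w cf α β := by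
      rw [sum_image]
      intro X hX Y hY hXY
      rw [Finset.mem_coe, mem_filter] at hX hY
      exact Prod.ext (hX.2.trans hY.2.symm) hXY
    rw [himg]
    refine sum_eq_sum_of_support (fun α hα => ?_) fun α hα => ?_
    · obtain ⟨β, _, hβ⟩ := exists_ne_zero_of_sum_ne_zero hα
      refine Finset.mem_image.mpr ⟨(γ, α), mem_filter.mpr ⟨mem_filter.mpr ⟨?_, hγ⟩, rfl⟩, rfl⟩
      exact mem_nearSet_of_chainT_ne_zero hc hL hϱ hS hγ hβ
    · obtain ⟨β, _, hβ⟩ := exists_ne_zero_of_sum_ne_zero hα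
      exact (mem_of_chainT_ne_zero hc hL hS hSW hW hβ).1
  rw [sum_congr rfl hinner, sum_const, card_planarBall, nsmul_eq_mul]

/-! ### VK.2  The collar rows -/

/-- ★ REST TOTAL: the rows over the collar cells `p.1 ∉ planarBall ρ` are bounded by `8r(2ρ+2r+1) · #layerCollar S r · (2r+1)³ · F(c) · (2m)²`.
[this file, g57] -/
theorem rest_total_le (hc : 0 < c) (hL : IsLayeredCrystal c a b w) {ϱ : ℝ} (hϱ : 0 ≤ ϱ) (cf : ℤ → E3) (S : Finset ℤ)
    {m : ℝ} (hm : ∀ α, ‖cf α‖ ≤ m) (ρ : ℕ) :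
    |∑ p ∈ (nearSet hc hL ϱ (planarBall (ρ + ⌊ϱ / c⌋₊) ×ˢ S)).filter (fun p => p.1 ∉ planarBall ρ),
        ∑ q ∈ nearSet hc hL ϱ (planarBall (ρ + ⌊ϱ / c⌋₊) ×ˢ S), nearFam ϱ a b w (cutProfile (planarBall (ρ + ⌊ϱ / c⌋₊)) cf) (p, q)| ≤
      ((8 * ⌊ϱ / c⌋₊ * (2 * ρ + 2 * ⌊ϱ / c⌋₊ + 1) * (layerCollar S ⌊ϱ / c⌋₊).card : ℕ) : ℝ) *
        ((((2 * ⌊ϱ / c⌋₊ + 1) ^ 3 : ℕ) : ℝ) * (kernelConst c * (2 * m) ^ 2)) := by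
  set r := ⌊ϱ / c⌋₊ with hr
  set P := nearSet hc hL ϱ (planarBall (ρ + r) ×ˢ S) with hP
  have hm0 : 0 ≤ m := (norm_nonneg _).trans (hm 0)
  have hmχ : ∀ X : Cell 2 × ℤ, ‖cutProfile (planarBall (ρ + r)) cf X.1 X.2‖ ≤ m := by
    intro X
    by_cases h : X.1 ∈ planarBall (ρ + r)
    · rw [cutProfile_of_mem cf h]; exact hm X.2
    · rw [cutProfile_of_not_mem cf h, norm_zero]; exact hm0
  refine (abs_sum_le_sum_abs _ _).trans ?_
  refine (sum_le_card_nsmul _ _ _ fun p _ => abs_row_nearFam_le_card hc hL hϱ _ hmχ p P).trans ?_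
  rw [nsmul_eq_mul]
  refine mul_le_mul_of_nonneg_right ?_ (mul_nonneg (Nat.cast_nonneg _) (mul_nonneg (kernelConst_nonneg hc) (sq_nonneg _)))
  -- the collar: `P_rest ⊆ (planarBall (ρ+2r) \ planarBall ρ) ×ˢ layerCollar S r`
  have hsub : P.filter (fun p => p.1 ∉ planarBall ρ) ⊆ (planarBall (ρ + r + r) \ planarBall ρ) ×ˢ layerCollar S r := by
    intro p hp
    obtain ⟨hpP, hp1⟩ := mem_filter.mp hp
    exact mem_product.mpr ⟨mem_sdiff.mpr ⟨fst_mem_planarBall_of_mem_nearSet hc hL hpP, hp1⟩, snd_mem_layerCollar_of_mem_nearSet hc hL hpP⟩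
  have hcard := Finset.card_le_card hsub
  rw [card_product, card_sdiff_of_subset (planarBall_mono (by omega)), card_planarBall, card_planarBall] at hcard
  have hid : (2 * (ρ + r + r) + 1) ^ 2 - (2 * ρ + 1) ^ 2 = 8 * r * (2 * ρ + 2 * r + 1) := by
    have : (2 * (ρ + r + r) + 1) ^ 2 = (2 * ρ + 1) ^ 2 + 8 * r * (2 * ρ + 2 * r + 1) := by ring
    omega
  rw [hid] at hcard
  exact_mod_cast hcard

end ChainCoerciveII

end Summit.AtomisticToContinuum.Crystallization.Theorems.ChartedZeroExcessLayeredLatticeLiouville
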